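import Summits.Ventures.CertifiedArithmetic.Expansions.IncircleStageBExpansion
import Summits.Ventures.CertifiedArithmetic.Expansions.ExpansionGrids
import Literature.ComputerArithmetic.Shewchuk1997.Orient3dStageA
import Mathlib.Tactic.Linarith
import Mathlib.Tactic.Ring
import Mathlib.Tactic.NormNum

/-!
# ORIENT3D exactly, in weakly nonoverlapping expansion arithmetic

NEW WORK of this development (ENGINES group, unit `eng-quad-4`; HONEST FRAMING: shared numerical
engines serving client cells; rigour lives in the verifiers; every published number belongs to a
client cell's ledger, not to the engines group).  Not a published result, hence under
`Summits/Ventures/` with no citation tag of its own; the algorithm is the non-adaptive exact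
three-dimensional orientation test of Shewchuk's public-domain `predicates.c` (routine
`orient3dexact`, as we understand its structure), whose text we do not hold — the definition below
is our transcription of that STRUCTURE and is what the theorems are about; nothing is claimed about
the C code itself.

THE SCHEME (`orient3dExact`).  With the four points `a, b, c, d ∈ F(p, e₀)³` as they are (no
differences, hence no tails), the determinant is expanded along the column of ones of the `4 × 4`
form: the six `xy`-minors `ab = a₁b₂ − b₁a₂`, `bc`, `cd`, `da`, `ac`, `bd` as four-component blocks
TWO-TWO-DIFF of two error-free TWO-PRODUCTs (`twoTwoProdDiff`, `Orient2dBlocks.lean`); the four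
`3 × 3` minors `bcd = bc ⊞ cd ⊞ (−bd)`, `cda = cd ⊞ da ⊞ ac`, `dab = da ⊞ ab ⊞ bd`,
`abc = ab ⊞ bc ⊞ (−ac)` by two FAST-EXPANSION-SUMs with zero elimination each (`orient3dMinor3`,
≤ 12 components; `−` is componentwise negation, `negComponents`); the cofactor terms
`adet = bcd ⊗ a₃`, `bdet = cda ⊗ (−b₃)`, `cdet = dab ⊗ c₃`, `ddet = abc ⊗ (−d₃)` by
SCALE-EXPANSION with zero elimination (`scaleExpansionZeroElim`, ≤ 24 components); and
`deter = (adet ⊞ bdet) ⊞ (cdet ⊞ ddet)` (≤ 96 components); the answer is the sign of the last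
component of `deter`.

WHAT IS PROVED (`p ≥ 4`; `fl` any round-to-nearest into `F(p, emin)` whose roundoff lies 2-below
its result, `RoundoffBelow 2` — e.g. ties-to-even; `tp` a two-product error-free on `F(p, e₀)²`
and on `F(p, 2e₀) × F(p, e₀)`; the twelve coordinates in `F(p, e₀)` with `2e₀ ≥ emin` and
`3e₀ ≥ emin`, i.e. no product of three coordinates' worth of magnitude underflows):
* `orient3dExact_spec` — `deter` is a NONEMPTY weakly nonoverlapping (hence nonoverlapping and
  increasing) expansion of at most 96 floats, all nonzero unless it is `⟨0⟩`, whose sum is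
  `orient3dDet a b c d` of `Orient3dStageA.lean` EXACTLY (the `4 × 4` cofactor form equals the
  translated `3 × 3` determinant (7) of [Shewchuk1997, §4.2] identically, `ring`).
* `orient3dExact_sign` — the last component decides: `det > 0 ↔ last > 0`, `det < 0 ↔ last < 0`,
  `det = 0 ↔ deter = ⟨0⟩` (Shewchuk's §2.8 sign test, `sign_sum_of_getLast_ne_zero`).
* Instances: `orient3dExact_fma_sign` (the FMA two-product `2Prod_FMA`) and the IEEE headline
  `orient3dExactRNE_correct` (round-to-nearest-even + FMA two-product; binary64: all coordinates
  multiples of `2^−358`).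
The tools are the invariants of this directory: the block lemma (`twoTwoProdDiff_spec`,
`twoTwoProdDiff_coarse`), Theorems 1–2 (`fastExpansionSumZeroElim_spec`) and Theorem 3 with zero
elimination (`scaleExpansionZeroElim_spec`), and the grid lemma
`onGrid_of_mem_fastExpansionSumZeroElim` (`ExpansionGrids.lean`) which keeps the three-minor sums
on the coarse format `F(p, 2e₀)` that the scaling step needs.  They are threaded through the
scheme by the bookkeeping predicate `ExactW p emin g n v l` ("`l` is a W-expansion of `≤ n` floats
of `F(p, emin) ∩ F(p, g)` with sum `v`").

HONEST SCOPE.  (1) This is the STANDALONE exact routine, not stage D of the adaptive `orient3dadapt`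
(which reuses stage B–C quantities and the coordinate-difference tails); both compute the sign of
the same determinant exactly, so either can close the adaptive predicate, but the component lists
differ.  (2) As in `Orient2d.lean`: zero elimination is modelled as a post-pass, the tree's merge
takes the first operand's component first on equal magnitudes, TWO-TWO-DIFF is EXPANSION-SUM of the
pair and the negated pair; no overflow model; the format hypothesis `F(p, e₀)` with `3e₀ ≥ emin`
excludes the gradual-underflow range.  (3) `predicates.c` negates `bd` and `ac` in place; we negate
copies (`negComponents`), the same numbers.

No separate numerical evidence was gathered: the theorems compose landed, individually evidenced
lemmas, and the only arithmetic fact is a polynomial identity checked by `ring`.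

Reference for the algorithm: J. R. Shewchuk, Discrete Comput. Geom. 18 (1997) 305–363, §4 and
`predicates.c` (`orient3dexact`) [Shewchuk1997].
-/

namespace Summit.Ventures.CertifiedArithmetic.Expansions

open Literature.ComputerArithmetic.JeannerodRump2018
open Literature.ComputerArithmetic.BoldoJeannerodMelquiondMuller2023 hiding twoSum twoSum_fst
  isFloat_twoSum
open Literature.ComputerArithmetic.Shewchuk1997

variable {p : ℕ} {emin : ℤ} {fl : ℚ → ℚ}

/-! ## The bookkeeping predicate -/

/-- The invariant carried by every intermediate expansion `l` of the scheme: `l` is weakly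
nonoverlapping, its components are floats of `F(p, emin)` lying in the coarse format `F(p, g)`,
its sum is the exact value `v`, and it has at most `n` components. -/
def ExactW (p : ℕ) (emin g : ℤ) (n : ℕ) (v : ℚ) (l : List ℚ) : Prop :=
  IsWeakExpansion l ∧ (∀ x ∈ l, IsFloat p emin x) ∧ (∀ x ∈ l, IsFloat p g x) ∧ l.sum = v ∧
    l.length ≤ n

namespace ExactW

variable {g : ℤ} {n : ℕ} {v : ℚ} {l : List ℚ} (h : ExactW p emin g n v l)
include h

/-- `l` is weakly nonoverlapping. -/
theorem weak : IsWeakExpansion l := h.1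

/-- The components of `l` are floats of `F(p, emin)`. -/
theorem float : ∀ x ∈ l, IsFloat p emin x := h.2.1

/-- The components of `l` lie in the coarse format `F(p, g)`. -/
theorem coarse : ∀ x ∈ l, IsFloat p g x := h.2.2.1

/-- The sum of `l` is the exact value `v`. -/
theorem sum_eq : l.sum = v := h.2.2.2.1

/-- `l` has at most `n` components. -/
theorem length_le : l.length ≤ n := h.2.2.2.2

end ExactW

/-! ## Componentwise negation -/

/-- Componentwise negation of an expansion (`predicates.c` negates the minor arrays `bd` and `ac`
in place before forming `bcd` and `abc`). -/
def negComponents (l : List ℚ) : List ℚ := l.map fun x => -x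

/-- Negation negates the sum. -/
theorem sum_negComponents (l : List ℚ) : (negComponents l).sum = -l.sum := by
  induction l with
  | nil => simp [negComponents]
  | cons x xs ih =>
    simp only [negComponents, List.map_cons, List.sum_cons] at ih ⊢
    rw [ih]; ring

/-- Negation keeps the floats of any format. -/
theorem isFloat_negComponents {e : ℤ} {l : List ℚ} (h : ∀ x ∈ l, IsFloat p e x) :
    ∀ x ∈ negComponents l, IsFloat p e x := by
  intro x hx
  obtain ⟨y, hy, rfl⟩ := List.mem_map.mp hx
  exact (h y hy).neg

/-- Negation keeps the invariant, negating the value (class W: `isWeakExpansion_map_neg`). -/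
theorem exactW_neg {g : ℤ} {n : ℕ} {v : ℚ} {l : List ℚ} (h : ExactW p emin g n v l) :
    ExactW p emin g n (-v) (negComponents l) :=
  ⟨isWeakExpansion_map_neg h.weak, isFloat_negComponents h.float, isFloat_negComponents h.coarse,
    by rw [sum_negComponents, h.sum_eq], by simpa [negComponents] using h.length_le⟩

/-! ## The building blocks carry the invariant -/

/-- A `2 × 2` minor block `⟨a ⊗ b − c ⊗ d⟩` over factors in `F(p, e₀)`, `2e₀ ≥ emin`, with
error-free two-products: four floats of `F(p, 2e₀)`, class W, sum `ab − cd` (the block lemma and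
its coarse-format companion). -/
theorem exactW_block (hp : 1 ≤ p) (hfl : IsRoundNearest p emin fl) (hfl2 : RoundoffBelow 2 fl)
    {e₀ : ℤ} (h2 : emin ≤ e₀ + e₀) {tp : ℚ → ℚ → ℚ × ℚ}
    (htp : ∀ x y, IsFloat p e₀ x → IsFloat p e₀ y → ExactTwoProd p emin fl tp x y)
    {a b c d : ℚ} (ha : IsFloat p e₀ a) (hb : IsFloat p e₀ b) (hc : IsFloat p e₀ c)
    (hd : IsFloat p e₀ d) :
    ExactW p emin (e₀ + e₀) 4 (a * b - c * d) (twoTwoProdDiff tp fl a b c d) := by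
  obtain ⟨W, S, L, F⟩ := twoTwoProdDiff_spec hp hfl hfl2 (htp _ _ ha hb) (htp _ _ hc hd)
  exact ⟨W, F, twoTwoProdDiff_coarse hp hfl hfl2 h2 ha hb hc hd (htp _ _ ha hb) (htp _ _ hc hd),
    S, L.le⟩

/-- FAST-EXPANSION-SUM with zero elimination keeps the invariant (`p ≥ 4`, coarse format
`g ≥ emin`): class W and floats by Theorems 1–2, the coarse format because the routine only adds,
rounds and subtracts multiples of `2^g` (`onGrid_of_mem_fastExpansionSumZeroElim`), the sum is the
sum of the values, the length at most `n₁ + n₂` (`≥ 1`). -/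
theorem exactW_fesze (hp : 4 ≤ p) (hfl : IsRoundNearest p emin fl) (hfl2 : RoundoffBelow 2 fl)
    {g : ℤ} (hg : emin ≤ g) {n₁ n₂ : ℕ} {v₁ v₂ : ℚ} {e f : List ℚ}
    (he : ExactW p emin g n₁ v₁ e) (hf : ExactW p emin g n₂ v₂ f) {n : ℕ} (hn : n₁ + n₂ ≤ n)
    (hn1 : 1 ≤ n) {v : ℚ} (hv : v₁ + v₂ = v) :
    ExactW p emin g n v (fastExpansionSumZeroElim fl e f) := by
  have hp1 : 1 ≤ p := le_trans (by norm_num) hp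
  obtain ⟨W, S, F, -, -, L⟩ :=
    fastExpansionSumZeroElim_spec hp hfl hfl2 he.float he.weak hf.float hf.weak
  have G : ∀ x ∈ fastExpansionSumZeroElim fl e f, OnGrid g x :=
    onGrid_of_mem_fastExpansionSumZeroElim hp1 hfl hg he.float hf.float
      (fun x hx => OnGrid.of_isFloat (he.coarse x hx))
      (fun x hx => OnGrid.of_isFloat (hf.coarse x hx))
  refine ⟨W, F, fun x hx => isFloat_of_isFloat_of_onGrid (F x hx) (G x hx), ?_, ?_⟩
  · rw [S, he.sum_eq, hf.sum_eq, hv]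
  · refine le_trans L (max_le ?_ hn1)
    have h₁ := he.length_le
    have h₂ := hf.length_le
    omega

/-- SCALE-EXPANSION with zero elimination by a coordinate `z ∈ F(p, e₀)` of an expansion on the
coarse format `F(p, 2e₀)`, `3e₀ ≥ emin` (no product underflows), error-free two-products on
`F(p, 2e₀) × F(p, e₀)`: class W, floats, sum `v·z`, at most `2n` components (Theorem 3 with zero
elimination; the coarse format is then no longer tracked, `g = emin`). -/
theorem exactW_scale (hp : 1 ≤ p) (hfl : IsRoundNearest p emin fl) (hfl2 : RoundoffBelow 2 fl)
    {e₀ : ℤ} (h3 : emin ≤ e₀ + e₀ + e₀) {tp : ℚ → ℚ → ℚ × ℚ}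
    (htp' : ∀ x y, IsFloat p (e₀ + e₀) x → IsFloat p e₀ y → ExactTwoProd p emin fl tp x y)
    {n : ℕ} {v : ℚ} {m : List ℚ} (hm : ExactW p emin (e₀ + e₀) n v m) {z : ℚ}
    (hz : IsFloat p e₀ z) {n' : ℕ} (hn : 2 * n ≤ n') (hn1 : 1 ≤ n') {w : ℚ} (hw : v * z = w) :
    ExactW p emin emin n' w (scaleExpansionZeroElim tp fl m z) := by
  obtain ⟨Mb, kb, hMb, hkb, hrep⟩ := hz
  have heU : ∀ x ∈ m, IsFloat p (emin - kb) x := fun x hx =>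
    isFloat_of_emin_le (by omega) (hm.coarse x hx)
  have htpS : ∀ x ∈ m, (tp x z).1 = fl (x * z) ∧ (tp x z).1 + (tp x z).2 = x * z := fun x hx =>
    let h := htp' x z (hm.coarse x hx) ⟨Mb, kb, hMb, hkb, hrep⟩
    ⟨h.1, h.2.1⟩
  obtain ⟨hW, hS, hF, -, -, hL⟩ :=
    scaleExpansionZeroElim_spec hp hfl hfl2 hrep hMb hm.float heU hm.weak htpS
  refine ⟨hW, hF, hF, by rw [hS, hm.sum_eq, hw], le_trans hL (max_le ?_ hn1)⟩
  have h₁ := hm.length_le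
  omega

/-! ## The scheme -/

/-- A `3 × 3` minor of the `4 × 4` form as the sum of three `2 × 2` minor blocks:
`(m₁ ⊞ m₂) ⊞ m₃`, FAST-EXPANSION-SUM with zero elimination twice (in `predicates.c` the first sum
goes to a temporary of eight components, the second to `bcd`, `cda`, `dab` or `abc`). -/
def orient3dMinor3 (fl : ℚ → ℚ) (m₁ m₂ m₃ : List ℚ) : List ℚ :=
  fastExpansionSumZeroElim fl (fastExpansionSumZeroElim fl m₁ m₂) m₃

/-- Three blocks of four on a coarse format `g ≥ emin` give a three-minor sum of at most twelve
components on the same format, class W, exact value `v₁ + v₂ + v₃` (`p ≥ 4`). -/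
theorem exactW_minor3 (hp : 4 ≤ p) (hfl : IsRoundNearest p emin fl) (hfl2 : RoundoffBelow 2 fl)
    {g : ℤ} (hg : emin ≤ g) {v₁ v₂ v₃ : ℚ} {m₁ m₂ m₃ : List ℚ} (h₁ : ExactW p emin g 4 v₁ m₁)
    (h₂ : ExactW p emin g 4 v₂ m₂) (h₃ : ExactW p emin g 4 v₃ m₃) :
    ExactW p emin g 12 (v₁ + v₂ + v₃) (orient3dMinor3 fl m₁ m₂ m₃) :=
  exactW_fesze hp hfl hfl2 hg (n := 12)
    (exactW_fesze hp hfl hfl2 hg h₁ h₂ (n := 8) (by norm_num) (by norm_num) rfl) h₃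
    (by norm_num) (by norm_num) rfl

/-- **ORIENT3D EXACTLY** (the structure of `predicates.c`'s `orient3dexact`) over a two-product
`tp` and a rounding `fl`, on the twelve coordinates of `a, b, c, d`: the zero-eliminated expansion
`deter = (bcd ⊗ a₃ ⊞ cda ⊗ (−b₃)) ⊞ (dab ⊗ c₃ ⊞ abc ⊗ (−d₃))` with
`bcd = bc ⊞ cd ⊞ (−bd)`, `cda = cd ⊞ da ⊞ ac`, `dab = da ⊞ ab ⊞ bd`, `abc = ab ⊞ bc ⊞ (−ac)` and
the blocks `pq = p₁ ⊗ q₂ − q₁ ⊗ p₂` (the C code returns `deter[deterlen − 1]`). -/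
def orient3dExact (tp : ℚ → ℚ → ℚ × ℚ) (fl : ℚ → ℚ)
    (a₁ a₂ a₃ b₁ b₂ b₃ c₁ c₂ c₃ d₁ d₂ d₃ : ℚ) : List ℚ :=
  fastExpansionSumZeroElim fl
    (fastExpansionSumZeroElim fl
      (scaleExpansionZeroElim tp fl
        (orient3dMinor3 fl (twoTwoProdDiff tp fl b₁ c₂ c₁ b₂) (twoTwoProdDiff tp fl c₁ d₂ d₁ c₂)
          (negComponents (twoTwoProdDiff tp fl b₁ d₂ d₁ b₂))) a₃)
      (scaleExpansionZeroElim tp fl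
        (orient3dMinor3 fl (twoTwoProdDiff tp fl c₁ d₂ d₁ c₂) (twoTwoProdDiff tp fl d₁ a₂ a₁ d₂)
          (twoTwoProdDiff tp fl a₁ c₂ c₁ a₂)) (-b₃)))
    (fastExpansionSumZeroElim fl
      (scaleExpansionZeroElim tp fl
        (orient3dMinor3 fl (twoTwoProdDiff tp fl d₁ a₂ a₁ d₂) (twoTwoProdDiff tp fl a₁ b₂ b₁ a₂)
          (twoTwoProdDiff tp fl b₁ d₂ d₁ b₂)) c₃)
      (scaleExpansionZeroElim tp fl
        (orient3dMinor3 fl (twoTwoProdDiff tp fl a₁ b₂ b₁ a₂) (twoTwoProdDiff tp fl b₁ c₂ c₁ b₂)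
          (negComponents (twoTwoProdDiff tp fl a₁ c₂ c₁ a₂))) (-d₃)))

/-- **THEOREM (ORIENT3D's exact routine computes an exact W-expansion of the determinant).**  Let
`p ≥ 4`, `fl` a round-to-nearest whose roundoff lies 2-below its result (e.g. ties-to-even), the
twelve coordinates in `F(p, e₀)` with `2e₀ ≥ emin` and `3e₀ ≥ emin`, and `tp` a two-product
error-free on `F(p, e₀)²` and on `F(p, 2e₀) × F(p, e₀)`.  Then `orient3dExact` is a NONEMPTY
weakly nonoverlapping expansion of at most 96 floats, all nonzero unless it is `⟨0⟩`, whose sum is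
the orientation determinant `orient3dDet` EXACTLY. -/
theorem orient3dExact_spec (hp : 4 ≤ p) (hfl : IsRoundNearest p emin fl) (hfl2 : RoundoffBelow 2 fl)
    {e₀ : ℤ} (h2 : emin ≤ e₀ + e₀) (h3 : emin ≤ e₀ + e₀ + e₀) {tp : ℚ → ℚ → ℚ × ℚ}
    (htp : ∀ x y, IsFloat p e₀ x → IsFloat p e₀ y → ExactTwoProd p emin fl tp x y)
    (htp' : ∀ x y, IsFloat p (e₀ + e₀) x → IsFloat p e₀ y → ExactTwoProd p emin fl tp x y)
    {a₁ a₂ a₃ b₁ b₂ b₃ c₁ c₂ c₃ d₁ d₂ d₃ : ℚ} (ha₁ : IsFloat p e₀ a₁) (ha₂ : IsFloat p e₀ a₂)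
    (ha₃ : IsFloat p e₀ a₃) (hb₁ : IsFloat p e₀ b₁) (hb₂ : IsFloat p e₀ b₂)
    (hb₃ : IsFloat p e₀ b₃) (hc₁ : IsFloat p e₀ c₁) (hc₂ : IsFloat p e₀ c₂)
    (hc₃ : IsFloat p e₀ c₃) (hd₁ : IsFloat p e₀ d₁) (hd₂ : IsFloat p e₀ d₂)
    (hd₃ : IsFloat p e₀ d₃) :
    IsWeakExpansion (orient3dExact tp fl a₁ a₂ a₃ b₁ b₂ b₃ c₁ c₂ c₃ d₁ d₂ d₃) ∧
      (orient3dExact tp fl a₁ a₂ a₃ b₁ b₂ b₃ c₁ c₂ c₃ d₁ d₂ d₃).sum =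
        orient3dDet a₁ a₂ a₃ b₁ b₂ b₃ c₁ c₂ c₃ d₁ d₂ d₃ ∧
      (∀ x ∈ orient3dExact tp fl a₁ a₂ a₃ b₁ b₂ b₃ c₁ c₂ c₃ d₁ d₂ d₃, IsFloat p emin x) ∧
      orient3dExact tp fl a₁ a₂ a₃ b₁ b₂ b₃ c₁ c₂ c₃ d₁ d₂ d₃ ≠ [] ∧
      ((∀ x ∈ orient3dExact tp fl a₁ a₂ a₃ b₁ b₂ b₃ c₁ c₂ c₃ d₁ d₂ d₃, x ≠ 0) ∨
        orient3dExact tp fl a₁ a₂ a₃ b₁ b₂ b₃ c₁ c₂ c₃ d₁ d₂ d₃ = [0]) ∧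
      (orient3dExact tp fl a₁ a₂ a₃ b₁ b₂ b₃ c₁ c₂ c₃ d₁ d₂ d₃).length ≤ 96 := by
  have hp1 : 1 ≤ p := le_trans (by norm_num) hp
  have M : ∀ {a b c d : ℚ}, IsFloat p e₀ a → IsFloat p e₀ b → IsFloat p e₀ c → IsFloat p e₀ d →
      ExactW p emin (e₀ + e₀) 4 (a * b - c * d) (twoTwoProdDiff tp fl a b c d) :=
    fun ha hb hc hd => exactW_block hp1 hfl hfl2 h2 htp ha hb hc hd
  have AB := M ha₁ hb₂ hb₁ ha₂
  have BC := M hb₁ hc₂ hc₁ hb₂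
  have CD := M hc₁ hd₂ hd₁ hc₂
  have DA := M hd₁ ha₂ ha₁ hd₂
  have AC := M ha₁ hc₂ hc₁ ha₂
  have BD := M hb₁ hd₂ hd₁ hb₂
  have BCD := exactW_minor3 (fl := fl) hp hfl hfl2 h2 BC CD (exactW_neg BD)
  have CDA := exactW_minor3 (fl := fl) hp hfl hfl2 h2 CD DA AC
  have DAB := exactW_minor3 (fl := fl) hp hfl hfl2 h2 DA AB BD
  have ABC := exactW_minor3 (fl := fl) hp hfl hfl2 h2 AB BC (exactW_neg AC)
  have Ad := exactW_scale hp1 hfl hfl2 h3 htp' BCD ha₃ (n' := 24) (by norm_num) (by norm_num) rfl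
  have Bd :=
    exactW_scale hp1 hfl hfl2 h3 htp' CDA hb₃.neg (n' := 24) (by norm_num) (by norm_num) rfl
  have Cd := exactW_scale hp1 hfl hfl2 h3 htp' DAB hc₃ (n' := 24) (by norm_num) (by norm_num) rfl
  have Dd :=
    exactW_scale hp1 hfl hfl2 h3 htp' ABC hd₃.neg (n' := 24) (by norm_num) (by norm_num) rfl
  have ABd := exactW_fesze hp hfl hfl2 le_rfl Ad Bd (n := 48) (by norm_num) (by norm_num) rfl
  have CDd := exactW_fesze hp hfl hfl2 le_rfl Cd Dd (n := 48) (by norm_num) (by norm_num) rfl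
  have D := exactW_fesze hp hfl hfl2 le_rfl ABd CDd (n := 96) (by norm_num) (by norm_num) rfl
  obtain ⟨-, -, -, N, Z, -⟩ :=
    fastExpansionSumZeroElim_spec hp hfl hfl2 ABd.float ABd.weak CDd.float CDd.weak
  refine ⟨D.weak, ?_, D.float, N, Z, D.length_le⟩
  unfold orient3dExact
  rw [D.sum_eq, orient3dDet]
  ring

/-- **The sign of the determinant from the exact expansion** (Shewchuk's §2.8 test on the
zero-eliminated nonoverlapping expansion): the LAST component of `orient3dExact` decides
`det > 0`, `det < 0`, and `det = 0 ↔ orient3dExact = ⟨0⟩`. -/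
theorem orient3dExact_sign (hp : 4 ≤ p) (hfl : IsRoundNearest p emin fl) (hfl2 : RoundoffBelow 2 fl)
    {e₀ : ℤ} (h2 : emin ≤ e₀ + e₀) (h3 : emin ≤ e₀ + e₀ + e₀) {tp : ℚ → ℚ → ℚ × ℚ}
    (htp : ∀ x y, IsFloat p e₀ x → IsFloat p e₀ y → ExactTwoProd p emin fl tp x y)
    (htp' : ∀ x y, IsFloat p (e₀ + e₀) x → IsFloat p e₀ y → ExactTwoProd p emin fl tp x y)
    {a₁ a₂ a₃ b₁ b₂ b₃ c₁ c₂ c₃ d₁ d₂ d₃ : ℚ} (ha₁ : IsFloat p e₀ a₁) (ha₂ : IsFloat p e₀ a₂)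
    (ha₃ : IsFloat p e₀ a₃) (hb₁ : IsFloat p e₀ b₁) (hb₂ : IsFloat p e₀ b₂)
    (hb₃ : IsFloat p e₀ b₃) (hc₁ : IsFloat p e₀ c₁) (hc₂ : IsFloat p e₀ c₂)
    (hc₃ : IsFloat p e₀ c₃) (hd₁ : IsFloat p e₀ d₁) (hd₂ : IsFloat p e₀ d₂)
    (hd₃ : IsFloat p e₀ d₃) :
    ∃ hD : orient3dExact tp fl a₁ a₂ a₃ b₁ b₂ b₃ c₁ c₂ c₃ d₁ d₂ d₃ ≠ [],
      (0 < orient3dDet a₁ a₂ a₃ b₁ b₂ b₃ c₁ c₂ c₃ d₁ d₂ d₃ ↔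
          0 < (orient3dExact tp fl a₁ a₂ a₃ b₁ b₂ b₃ c₁ c₂ c₃ d₁ d₂ d₃).getLast hD) ∧
        (orient3dDet a₁ a₂ a₃ b₁ b₂ b₃ c₁ c₂ c₃ d₁ d₂ d₃ < 0 ↔
          (orient3dExact tp fl a₁ a₂ a₃ b₁ b₂ b₃ c₁ c₂ c₃ d₁ d₂ d₃).getLast hD < 0) ∧
        (orient3dDet a₁ a₂ a₃ b₁ b₂ b₃ c₁ c₂ c₃ d₁ d₂ d₃ = 0 ↔
          orient3dExact tp fl a₁ a₂ a₃ b₁ b₂ b₃ c₁ c₂ c₃ d₁ d₂ d₃ = [0]) := by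
  obtain ⟨hW, hS, hF, hne, hZ, -⟩ := orient3dExact_spec hp hfl hfl2 h2 h3 htp htp'
    ha₁ ha₂ ha₃ hb₁ hb₂ hb₃ hc₁ hc₂ hc₃ hd₁ hd₂ hd₃
  refine ⟨hne, ?_⟩
  rw [← hS]
  rcases hZ with hnz | h0
  · obtain ⟨s₁, s₂, s₃⟩ :=
      sign_sum_of_getLast_ne_zero hF hW.isExpansion hne (hnz _ (List.getLast_mem hne))
    refine ⟨s₁, s₂, ⟨fun h => absurd h s₃, fun h => ?_⟩⟩
    exfalso
    rw [h] at hnz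
    exact hnz 0 (List.mem_singleton_self 0) rfl
  · have key : ∀ (L : List ℚ) (h : L ≠ []), L = [0] → L.getLast h = 0 ∧ L.sum = 0 := by
      rintro L h rfl; exact ⟨rfl, by simp⟩
    obtain ⟨hl, hs0⟩ := key _ hne h0
    rw [hl, hs0]
    exact ⟨Iff.rfl, Iff.rfl, ⟨fun _ => h0, fun _ => rfl⟩⟩

/-! ## Instances: the FMA two-product; IEEE round-to-nearest-even -/

/-- **With the FMA two-product** (`2Prod_FMA`, any `RoundoffBelow 2` round-to-nearest, `p ≥ 4`):
the sign test is exact for coordinates in `F(p, e₀)`, `2e₀ ≥ emin`, `3e₀ ≥ emin`. -/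
theorem orient3dExact_fma_sign (hp : 4 ≤ p) (hfl : IsRoundNearest p emin fl)
    (hfl2 : RoundoffBelow 2 fl) {e₀ : ℤ} (h2 : emin ≤ e₀ + e₀) (h3 : emin ≤ e₀ + e₀ + e₀)
    {a₁ a₂ a₃ b₁ b₂ b₃ c₁ c₂ c₃ d₁ d₂ d₃ : ℚ} (ha₁ : IsFloat p e₀ a₁) (ha₂ : IsFloat p e₀ a₂)
    (ha₃ : IsFloat p e₀ a₃) (hb₁ : IsFloat p e₀ b₁) (hb₂ : IsFloat p e₀ b₂)
    (hb₃ : IsFloat p e₀ b₃) (hc₁ : IsFloat p e₀ c₁) (hc₂ : IsFloat p e₀ c₂)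
    (hc₃ : IsFloat p e₀ c₃) (hd₁ : IsFloat p e₀ d₁) (hd₂ : IsFloat p e₀ d₂)
    (hd₃ : IsFloat p e₀ d₃) :
    ∃ hD : orient3dExact (twoProdFMA fl) fl a₁ a₂ a₃ b₁ b₂ b₃ c₁ c₂ c₃ d₁ d₂ d₃ ≠ [],
      (0 < orient3dDet a₁ a₂ a₃ b₁ b₂ b₃ c₁ c₂ c₃ d₁ d₂ d₃ ↔
          0 < (orient3dExact (twoProdFMA fl) fl a₁ a₂ a₃ b₁ b₂ b₃ c₁ c₂ c₃ d₁ d₂ d₃).getLast hD) ∧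
        (orient3dDet a₁ a₂ a₃ b₁ b₂ b₃ c₁ c₂ c₃ d₁ d₂ d₃ < 0 ↔
          (orient3dExact (twoProdFMA fl) fl a₁ a₂ a₃ b₁ b₂ b₃ c₁ c₂ c₃ d₁ d₂ d₃).getLast hD < 0) ∧
        (orient3dDet a₁ a₂ a₃ b₁ b₂ b₃ c₁ c₂ c₃ d₁ d₂ d₃ = 0 ↔
          orient3dExact (twoProdFMA fl) fl a₁ a₂ a₃ b₁ b₂ b₃ c₁ c₂ c₃ d₁ d₂ d₃ = [0]) :=
  have hp1 : 1 ≤ p := le_trans (by norm_num) hp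
  orient3dExact_sign hp hfl hfl2 h2 h3
    (fun _ _ hx hy => exactTwoProd_twoProdFMA₂ hp1 hfl h2 hx hy)
    (fun _ _ hx hy => exactTwoProd_twoProdFMA₂ hp1 hfl h3 hx hy)
    ha₁ ha₂ ha₃ hb₁ hb₂ hb₃ hc₁ hc₂ hc₃ hd₁ hd₂ hd₃

/-- ORIENT3D's exact routine as run on a round-to-nearest-even machine with the FMA two-product,
precision `p`, underflow threshold `emin`. -/
def orient3dExactRNE (p : ℕ) (emin : ℤ) (a₁ a₂ a₃ b₁ b₂ b₃ c₁ c₂ c₃ d₁ d₂ d₃ : ℚ) : List ℚ :=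
  orient3dExact (twoProdFMA (roundTiesEven p emin)) (roundTiesEven p emin)
    a₁ a₂ a₃ b₁ b₂ b₃ c₁ c₂ c₃ d₁ d₂ d₃

/-- **ORIENT3D's exact routine IS CORRECT ON AN IEEE MACHINE** (round-to-nearest-even, FMA
two-product, `p ≥ 4`): for coordinates in `F(p, e₀)` with `emin ≤ 2e₀` and `emin ≤ 3e₀` (binary64,
`p = 53`, `emin = −1074`: all twelve coordinates multiples of `2^−358`), the computed expansion is
a weakly nonoverlapping expansion of floats with `Σ = orient3dDet` exactly, and its last component
has the sign of the determinant, with `det = 0 ↔ ⟨0⟩`. -/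
theorem orient3dExactRNE_correct (hp : 4 ≤ p) {e₀ : ℤ} (h2 : emin ≤ e₀ + e₀)
    (h3 : emin ≤ e₀ + e₀ + e₀) {a₁ a₂ a₃ b₁ b₂ b₃ c₁ c₂ c₃ d₁ d₂ d₃ : ℚ}
    (ha₁ : IsFloat p e₀ a₁) (ha₂ : IsFloat p e₀ a₂) (ha₃ : IsFloat p e₀ a₃)
    (hb₁ : IsFloat p e₀ b₁) (hb₂ : IsFloat p e₀ b₂) (hb₃ : IsFloat p e₀ b₃)
    (hc₁ : IsFloat p e₀ c₁) (hc₂ : IsFloat p e₀ c₂) (hc₃ : IsFloat p e₀ c₃)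
    (hd₁ : IsFloat p e₀ d₁) (hd₂ : IsFloat p e₀ d₂) (hd₃ : IsFloat p e₀ d₃) :
    IsWeakExpansion (orient3dExactRNE p emin a₁ a₂ a₃ b₁ b₂ b₃ c₁ c₂ c₃ d₁ d₂ d₃) ∧
      (orient3dExactRNE p emin a₁ a₂ a₃ b₁ b₂ b₃ c₁ c₂ c₃ d₁ d₂ d₃).sum =
        orient3dDet a₁ a₂ a₃ b₁ b₂ b₃ c₁ c₂ c₃ d₁ d₂ d₃ ∧
      (∀ x ∈ orient3dExactRNE p emin a₁ a₂ a₃ b₁ b₂ b₃ c₁ c₂ c₃ d₁ d₂ d₃, IsFloat p emin x) ∧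
      ∃ hD : orient3dExactRNE p emin a₁ a₂ a₃ b₁ b₂ b₃ c₁ c₂ c₃ d₁ d₂ d₃ ≠ [],
        (0 < orient3dDet a₁ a₂ a₃ b₁ b₂ b₃ c₁ c₂ c₃ d₁ d₂ d₃ ↔
            0 < (orient3dExactRNE p emin a₁ a₂ a₃ b₁ b₂ b₃ c₁ c₂ c₃ d₁ d₂ d₃).getLast hD) ∧
          (orient3dDet a₁ a₂ a₃ b₁ b₂ b₃ c₁ c₂ c₃ d₁ d₂ d₃ < 0 ↔
            (orient3dExactRNE p emin a₁ a₂ a₃ b₁ b₂ b₃ c₁ c₂ c₃ d₁ d₂ d₃).getLast hD < 0) ∧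
          (orient3dDet a₁ a₂ a₃ b₁ b₂ b₃ c₁ c₂ c₃ d₁ d₂ d₃ = 0 ↔
            orient3dExactRNE p emin a₁ a₂ a₃ b₁ b₂ b₃ c₁ c₂ c₃ d₁ d₂ d₃ = [0]) := by
  have hp1 : 1 ≤ p := le_trans (by norm_num) hp
  have hfl : IsRoundNearest p emin (roundTiesEven p emin) := isRoundNearest_roundTiesEven hp1
  have hfl2 : RoundoffBelow 2 (roundTiesEven p emin) := roundoffBelow_two_roundTiesEven p emin
  have htp : ∀ x y, IsFloat p e₀ x → IsFloat p e₀ y →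
      ExactTwoProd p emin (roundTiesEven p emin) (twoProdFMA (roundTiesEven p emin)) x y :=
    fun x y hx hy => exactTwoProd_twoProdFMA₂ hp1 hfl h2 hx hy
  have htp' : ∀ x y, IsFloat p (e₀ + e₀) x → IsFloat p e₀ y →
      ExactTwoProd p emin (roundTiesEven p emin) (twoProdFMA (roundTiesEven p emin)) x y :=
    fun x y hx hy => exactTwoProd_twoProdFMA₂ hp1 hfl h3 hx hy
  obtain ⟨hW, hS, hF, -, -, -⟩ := orient3dExact_spec hp hfl hfl2 h2 h3 htp htp'
    ha₁ ha₂ ha₃ hb₁ hb₂ hb₃ hc₁ hc₂ hc₃ hd₁ hd₂ hd₃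
  exact ⟨hW, hS, hF, orient3dExact_sign hp hfl hfl2 h2 h3 htp htp'
    ha₁ ha₂ ha₃ hb₁ hb₂ hb₃ hc₁ hc₂ hc₃ hd₁ hd₂ hd₃⟩

end Summit.Ventures.CertifiedArithmetic.Expansions
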